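import Summits.BirchSwinnertonDyer.Rank1Residual.X5.TransverseRelaxedStrictCountLevels
import HarnessLib

/-!
# `K = ℚ`, `p = 2`: `a(T) − b(T) = 1 + e` at EVERY solitaire level `T` —
# `[H¹_{𝓚(T)^{2}}(ℚ, E[2]) : H¹_{𝓚(T)_{2}}(ℚ, E[2])] = 2 · #E(ℚ₂)[2]`
# (cell `b2b-bsdres`; O1 PROVER ORDER v2.8 item (ii) G3-T4, follow-up (ii-b); file 3 of 3, sequel of
# `X5/TransverseRelaxedStrictCountLevels.lean`; seat x11b3-p9 GEN 3, cross-cell pool work)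

HONEST FRAMING (cell `b2b-bsdres`, run/shared/lean/b2b/bsd-rank1-residual/, verbatim in every file): the
goal of the cell is to DELETE the COMBINATION-SHAPED residual classes of the Birch–Swinnerton-Dyer
formula for ALL analytic-rank `≤ 1` elliptic curves over `ℚ` — "full BSD formula for every rank `≤ 1`
curve in class `C`" assembled STRICTLY from published theorems — so that the rank-`≤ 1` remainder
becomes exactly the CONSTRUCTION-SHAPED classes, which are TYPED (missing-input `Prop`s), NOT
attempted. This is not "finishing BSD". Team O1 (X5 at `p = 2`): research routes; O1 OPEN; nothing
booked; no mark / label / count moved. THEOREMS ONLY: no definition, no named fact is minted, no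
`sorry`. CONDITIONAL on: a family `inv` of local invariant maps at level `2` with the three Poitou–Tate
properties of `poitouTate_selmerStructure_duality ℚ` (`IsPerfect`, `SumLocalTermEqZero`,
`SelmerComplement`) and injective at the real place (`hreal`: `Br(ℝ)[2] = ℤ/2` — NOT in the tree's fact,
ASK L-G18.1), and Tate's local Euler–Poincaré characteristic at the finite places (`hEP`).  The
Kolyvagin-prime inputs are DISCHARGED over `ℚ`: `N𝔮` prime (`Ash2003.residueCard_prime`), `ℚ_ℓ(μ_ℓ)/ℚ_ℓ`
totally ramified (`GaloisImage.modPCyclotomicCharacter_surjOn_absInertia_rat_holds`, Serre LF IV §4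
Prop. 17), `(ℓ − 1)·E[2] = 0` (`ℓ` odd), and at the Frobenius-class primes of a transposition `τ` also
`2 ∉ 𝔮`, unramifiedness and the cyclicity flag (file 2 §N5; `Gal(ℚ̄/ℚ(μ₂)) = Γ_ℚ`).

## What this file proves

* `absNorm_sub_one_smul_geomTorsion_two_eq_zero` — `(N𝔮 − 1)·E[2] = 0` at an odd prime `𝔮` of `ℚ`;
* **`relIndex_level_eq_two_mul_rat`** — for every finite set `T` of ODD primes of GOOD reduction at
  which the `Γ_{ℚ_ℓ}`-fixed `2`-torsion is cyclic (generator form, §M of `X5/TransverseSelfDual`):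
  `[H¹_{𝓚(T)^{2}} : H¹_{𝓚(T)_{2}}] = 2 · #E(ℚ₂)[2]`; `relIndex_level_eq_two_mul_rat_of_natCard_le` —
  the same with the cyclicity FLAG `#E[2]^{Γ_{ℚ_ℓ}} ≤ 2` (the `2`-division cubic has at most one root
  in `ℚ_ℓ`);
* `rootsOfUnityFixer_two_eq_top` — every `σ ∈ Γ_K` fixes `±1`: `Gal(K̄/K(μ₂)) = Γ_K`;
* **`relIndex_level_eq_two_mul_rat_of_mem_frobeniusClassPrimes`** — for a transposition `τ` on `E[2]`
  (`E[2]/(τ − 1) ≃ ℤ/2`) and EVERY finite set `T` of Frobenius-class primes of `τ` (the Kolyvagin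
  primes of `(E, 2)`, Mazur–Rubin §3.5): `[H¹_{𝓚(T)^{2}} : H¹_{𝓚(T)_{2}}] = 2 · #E(ℚ₂)[2]` with NO
  per-prime hypothesis left — REFUTER-O1 §19 D5's **`a(T) − b(T) = 1 + e`** (`e = dim E(ℚ₂)[2]`) at
  every vertex `T` of lens-2's solitaire cube / Mazur–Rubin's Selmer sheaf;
* **`relIndex_level_eq_two_mul_rat_of_facts`** — THE END STATEMENT: the same, `inv`-free, CONDITIONAL on
  exactly the two cited named facts `poitouTate_selmerStructure_duality_real ℚ` (b2b-bsdres-lit GEN 53,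
  p283639; ASK L-G18.1 CLOSED) and `localEulerPoincareCharacteristic (ℚ_v)` taken as hypotheses;
  `natCard_selmerGroup_level_relaxed_eq_of_facts` — its cardinality form
  `#H¹_{𝓚(T)^{2}} = 2 · #E(ℚ₂)[2] · #H¹_{𝓚(T)_{2}}`.

References: [MazurRubin2004] Def. 2.1.1, §3.5, §4.3; [MazurRubin2004Intro] Def. 4.2, §5;
[Rubin2011] Def. 1.9.4, Prop. 1.9.5, Def. 2.1.3; [MilneADT2006] I Thm. 2.8, Thm. 2.13, Thm. 4.10,
Lemma 6.15; [SerreLocalFields1979] IV §4 Prop. 17–18; [Howard2004HeegnerKolyvagin] Thm. 2.1.11.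
-/

noncomputable section

open scoped Classical

open CategoryTheory Field Function NumberField IsDedekindDomain WeierstrassCurve
open Literature.NumberTheory.EllipticCurves
open Literature.NumberTheory.GaloisRepresentations
open Literature.NumberTheory.GaloisRepresentations.DiscreteGaloisModule (mu MuCarrier SelmerStructure
  localTatePairingZMod tateDual localMap transverseSubgroup)
open Literature.NumberTheory.GaloisCohomology
open Summit.BirchSwinnertonDyer.Rank1Residual.X11b.LocBridge
open Summit.BirchSwinnertonDyer.Rank1Residual.X11b.Levels
open scoped ContRepresentation

namespace Summit.BirchSwinnertonDyer.Rank1Residual.X5.TransverseCount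

/-! ## §N4. `K = ℚ`, `p = 2`, `v₀ = v₂`: `a(T) − b(T) = 1 + e` at every solitaire level `T` -/

section RatTwo

variable (W : WeierstrassCurve ℚ) [W.IsElliptic]

omit [W.IsElliptic] in
/-- At an odd prime `𝔮 = (ℓ)` of `ℚ` (`2 ∉ 𝔮`), `(N𝔮 − 1)·P = 0` for every `P ∈ E[2]`: `N𝔮 = ℓ` is an
odd prime (`Ash2003.residueCard_prime`, `Ideal.absNorm_mem`). [folklore] -/
theorem absNorm_sub_one_smul_geomTorsion_two_eq_zero {q : HeightOneSpectrum (𝓞 ℚ)}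
    (h2q : ((2 : ℕ) : 𝓞 ℚ) ∉ q.asIdeal) (m : geomTorsion W ((2 : ℕ) : ℤ)) :
    (Ideal.absNorm q.asIdeal - 1) • m = 0 := by
  have hprime : (Ideal.absNorm q.asIdeal).Prime := Literature.NumberTheory.Automorphic.Ash2003.residueCard_prime q
  have hne : Ideal.absNorm q.asIdeal ≠ 2 := fun h => by
    apply h2q
    have hmem : ((Ideal.absNorm q.asIdeal : ℕ) : 𝓞 ℚ) ∈ q.asIdeal := Ideal.absNorm_mem q.asIdeal
    rwa [h] at hmem
  have hdvd : 2 ∣ Ideal.absNorm q.asIdeal - 1 := by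
    rcases hprime.eq_two_or_odd' with h | h
    · exact absurd h hne
    · exact (Nat.Odd.sub_odd h odd_one).two_dvd
  have h2 : (2 : ℕ) • m = 0 := AddSubgroup.torsionBy.nsmul m
  exact addOrderOf_dvd_iff_nsmul_eq_zero.mp ((addOrderOf_dvd_of_nsmul_eq_zero h2).trans hdvd)

/-- **O1 / REFUTER-O1 §19 D5 at EVERY solitaire level ("`a(T) − b(T) = 1 + e`").**  For an elliptic
curve `E/ℚ`, the place `v₂` above `2`, a family `inv` of local invariant maps at level `2` with the
three Poitou–Tate properties of `poitouTate_selmerStructure_duality ℚ` and injective at the real place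
(`hreal`; `Br(ℝ)[2] = ℤ/2` — a HYPOTHESIS), GIVEN Tate's local Euler–Poincaré characteristic at the
finite places (`hEP`), and for every finite set `T` of ODD primes of GOOD reduction at which the
`Γ_{ℚ_ℓ}`-fixed `2`-torsion is CYCLIC (`hcyc`: the `2`-division cubic does not split completely mod `ℓ` —
at a Kolyvagin prime of `(E, 2)` the Frobenius is a transposition on `E[2]`):

  `[H¹_{𝓚(T)^{2}}(ℚ, E[2]) : H¹_{𝓚(T)_{2}}(ℚ, E[2])] = 2 · #E(ℚ₂)[2]`,

where `𝓚(T)` is the Kummer (`2`-descent) structure with the transverse condition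
`ker(H¹(ℚ_ℓ, E[2]) → H¹(ℚ_ℓ(μ_ℓ), E[2]))` at the primes `ℓ ∈ T`, `𝓚(T)^{2}` / `𝓚(T)_{2}` its relaxed /
strict modification at `v₂`, and `E(ℚ₂)[2]` the `2`-torsion over the completion `ℚ_{v₂}`.  In
`𝔽₂`-dimensions `a(T) − b(T) = 1 + e`, `e = dim E(ℚ₂)[2]`, at EVERY level `T`.  The inputs `N𝔮` prime
(`Ash2003.residueCard_prime`), `ℚ_ℓ(μ_ℓ)/ℚ_ℓ` totally ramified
(`GaloisImage.modPCyclotomicCharacter_surjOn_absInertia_rat_holds`, Serre LF IV §4 Prop. 17),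
`(ℓ − 1)·E[2] = 0` and the unramifiedness of `E[2]` at `ℓ` (`X11b.AcSelmer.isUnramifiedAt_torsionGaloisModule`)
are DISCHARGED; `#(ℤ₂/2ℤ₂) = 2` is n1011's `GaloisImage.natCard_quot_adicCompletionIntegers_of_prime_mem`.
CONDITIONAL on the stated hypotheses; EVIDENCE-neutral; nothing booked; O1 OPEN.
[cite: MazurRubin2004, Def. 2.1.1 and §4.3]
[cite: MilneADT2006, Ch. I, Thm. 2.8, Thm. 2.13, Cor. 3.4, Thm. 4.10 and Lemma 6.15]
[cite: SerreLocalFields1979, Ch. IV §4, Prop. 17] [cite: Rubin2011, Def. 1.9.4 and Prop. 1.9.5 (pp. 14–16)] -/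
theorem relIndex_level_eq_two_mul_rat (inv : LocalInvariants ℚ 2)
    (hperf : inv.IsPerfect) (hvan : inv.SumLocalTermEqZero) (hcomp : inv.SelmerComplement)
    (hEP : ∀ v : HeightOneSpectrum (𝓞 ℚ), localEulerPoincareCharacteristic (v.adicCompletion ℚ))
    (hreal : ∀ w : InfinitePlace ℚ, w.IsReal → Injective (inv (Sum.inl w)))
    (T : Finset (HeightOneSpectrum (𝓞 ℚ)))
    (h2T : ∀ q ∈ T, ((2 : ℕ) : 𝓞 ℚ) ∉ q.asIdeal) (hgood : ∀ q ∈ T, W.HasGoodReductionAt q)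
    (hcyc : ∀ q ∈ T, ∃ R : geomTorsion W ((2 : ℕ) : ℤ), ∀ S : geomTorsion W ((2 : ℕ) : ℤ),
      (∀ g : absoluteGaloisGroup (q.adicCompletion ℚ),
        GaloisRep.toLocal q (W.torsionGaloisModule ((2 : ℕ) : ℤ)) g S = S) → ∃ a : ℕ, S = a • R)
    {v₂ : HeightOneSpectrum (𝓞 ℚ)} (hv₂ : ((2 : ℕ) : 𝓞 ℚ) ∈ v₂.asIdeal) :
    (SelmerStructure.selmerGroup (Function.update
          ((W.kummerSelmerStructure ((2 : ℕ) : ℤ)).transverseAt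
            (cyclotomicTransverse (W.torsionGaloisModule ((2 : ℕ) : ℤ))) T) (Sum.inr v₂) ⊥ :
          SelmerStructure (W.torsionGaloisModule ((2 : ℕ) : ℤ)))).relIndex
        (SelmerStructure.selmerGroup (Function.update
          ((W.kummerSelmerStructure ((2 : ℕ) : ℤ)).transverseAt
            (cyclotomicTransverse (W.torsionGaloisModule ((2 : ℕ) : ℤ))) T) (Sum.inr v₂) ⊤ :
          SelmerStructure (W.torsionGaloisModule ((2 : ℕ) : ℤ)))) =
      2 * Nat.card (nsmulAddMonoidHom 2 : (W.baseChange (v₂.adicCompletion ℚ)).toAffine.Point →+ _).ker := by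
  haveI : Fact (Nat.Prime 2) := ⟨Nat.prime_two⟩
  rw [relIndex_transverseAt_update_bot_update_top_eq W 2 inv hperf hvan hcomp hEP hreal T h2T
      (fun q hq => X11b.AcSelmer.isUnramifiedAt_torsionGaloisModule W (hgood q hq)
        (by rw [Int.cast_natCast]; exact h2T q hq))
      (fun q _ => Literature.NumberTheory.Automorphic.Ash2003.residueCard_prime q)
      (fun q hq m => absNorm_sub_one_smul_geomTorsion_two_eq_zero W (h2T q hq) m)
      (fun q _ _ _ => GaloisImage.modPCyclotomicCharacter_surjOn_absInertia_rat_holds q) hcyc v₂,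
    GaloisImage.natCard_quot_adicCompletionIntegers_of_prime_mem 2 hv₂, mul_comm]

/-- **`a(T) − b(T) = 1 + e` with the CYCLICITY FLAG** `#E[2]^{Γ_{ℚ_ℓ}} ≤ 2` at each `ℓ ∈ T` (the
`2`-division cubic has at most one root in `ℚ_ℓ`) in place of the generator hypothesis.
[cite: MazurRubin2004, Def. 2.1.1 and §4.3] [cite: MilneADT2006, Ch. I, Thm. 2.8 and Thm. 4.10] -/
theorem relIndex_level_eq_two_mul_rat_of_natCard_le (inv : LocalInvariants ℚ 2)
    (hperf : inv.IsPerfect) (hvan : inv.SumLocalTermEqZero) (hcomp : inv.SelmerComplement)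
    (hEP : ∀ v : HeightOneSpectrum (𝓞 ℚ), localEulerPoincareCharacteristic (v.adicCompletion ℚ))
    (hreal : ∀ w : InfinitePlace ℚ, w.IsReal → Injective (inv (Sum.inl w)))
    (T : Finset (HeightOneSpectrum (𝓞 ℚ)))
    (h2T : ∀ q ∈ T, ((2 : ℕ) : 𝓞 ℚ) ∉ q.asIdeal) (hgood : ∀ q ∈ T, W.HasGoodReductionAt q)
    (hflag : ∀ q ∈ T, Nat.card {S : geomTorsion W ((2 : ℕ) : ℤ) //
      ∀ g : absoluteGaloisGroup (q.adicCompletion ℚ),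
        GaloisRep.toLocal q (W.torsionGaloisModule ((2 : ℕ) : ℤ)) g S = S} ≤ 2)
    {v₂ : HeightOneSpectrum (𝓞 ℚ)} (hv₂ : ((2 : ℕ) : 𝓞 ℚ) ∈ v₂.asIdeal) :
    (SelmerStructure.selmerGroup (Function.update
          ((W.kummerSelmerStructure ((2 : ℕ) : ℤ)).transverseAt
            (cyclotomicTransverse (W.torsionGaloisModule ((2 : ℕ) : ℤ))) T) (Sum.inr v₂) ⊥ :
          SelmerStructure (W.torsionGaloisModule ((2 : ℕ) : ℤ)))).relIndex
        (SelmerStructure.selmerGroup (Function.update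
          ((W.kummerSelmerStructure ((2 : ℕ) : ℤ)).transverseAt
            (cyclotomicTransverse (W.torsionGaloisModule ((2 : ℕ) : ℤ))) T) (Sum.inr v₂) ⊤ :
          SelmerStructure (W.torsionGaloisModule ((2 : ℕ) : ℤ)))) =
      2 * Nat.card (nsmulAddMonoidHom 2 : (W.baseChange (v₂.adicCompletion ℚ)).toAffine.Point →+ _).ker := by
  haveI : Fact (Nat.Prime 2) := ⟨Nat.prime_two⟩
  rw [relIndex_transverseAt_update_bot_update_top_eq_of_natCard_le W 2 inv hperf hvan hcomp hEP hreal T h2T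
      (fun q hq => X11b.AcSelmer.isUnramifiedAt_torsionGaloisModule W (hgood q hq)
        (by rw [Int.cast_natCast]; exact h2T q hq))
      (fun q _ => Literature.NumberTheory.Automorphic.Ash2003.residueCard_prime q)
      (fun q hq m => absNorm_sub_one_smul_geomTorsion_two_eq_zero W (h2T q hq) m)
      (fun q _ _ _ => GaloisImage.modPCyclotomicCharacter_surjOn_absInertia_rat_holds q) hflag v₂,
    GaloisImage.natCard_quot_adicCompletionIntegers_of_prime_mem 2 hv₂, mul_comm]

/-- **`Gal(K̄/K(μ₂)) = Γ_K`**: every Galois automorphism fixes the square roots of unity `±1 ∈ K`.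
[folklore] -/
theorem rootsOfUnityFixer_two_eq_top (K : Type*) [Field K] : rootsOfUnityFixer K 2 = ⊤ := by
  refine Subgroup.ext fun σ => ⟨fun _ => Subgroup.mem_top σ, fun _ => ?_⟩
  rw [mem_rootsOfUnityFixer_iff]
  intro t ht
  have h : (t - 1) * (t + 1) = 0 := by ring_nf; rw [ht]; ring
  rcases mul_eq_zero.mp h with h1 | h1
  · rw [sub_eq_zero] at h1
    rw [h1, smul_one]
  · rw [add_eq_zero_iff_eq_neg] at h1
    rw [h1, smul_neg, smul_one]

/-- **`a(T) − b(T) = 1 + e` AT THE KOLYVAGIN PRIMES, NO PER-PRIME HYPOTHESIS LEFT.**  For `E/ℚ`, a Galois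
automorphism `τ` acting on `E[2]` with `E[2]/(τ − 1)E[2] ≃ ℤ/2` (a transposition of the three
non-trivial `2`-torsion points — Mazur–Rubin's `τ` at `p = 2`), any set `S` of primes, and EVERY finite
set `T ⊆ frobeniusClassPrimes E[2] S τ 2` (the primes `ℓ ∉ S`, `ℓ ∤ 2`, unramified in `ℚ(E[2])`, with
Frobenius in the class of `τ` — the Kolyvagin primes of `(E, 2)`; `μ₂ ⊂ ℚ` so the cyclotomic
condition is void, `rootsOfUnityFixer_two_eq_top`):

  `[H¹_{𝓚(T)^{2}}(ℚ, E[2]) : H¹_{𝓚(T)_{2}}(ℚ, E[2])] = 2 · #E(ℚ_{v₂})[2]`,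

GIVEN only the global inputs `inv` (Poitou–Tate properties of `poitouTate_selmerStructure_duality ℚ` +
`hreal`) and `hEP` (Tate's local Euler characteristic).  This is REFUTER-O1 §19 D5 / lens-2's
`a(n) − b(n) = 1 + e` at EVERY vertex `n` of the solitaire cube (ORDER v2.8 (ii-b)); the per-prime
inputs come from file 2 §N5 (`2 ∉ 𝔮`, unramified, `(N𝔮 − 1)·E[2] = 0`, cyclicity flag `= 2`) and from
`Ash2003.residueCard_prime` / `GaloisImage.modPCyclotomicCharacter_surjOn_absInertia_rat_holds`.
CONDITIONAL on `inv`/`hEP`/`hreal`; EVIDENCE-neutral; nothing booked; O1 OPEN.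
[cite: MazurRubin2004, §3.5 and §4.3] [cite: MazurRubin2004Intro, Def. 4.2 and §5]
[cite: Rubin2011, Def. 2.1.3 (p. 17)] [cite: MilneADT2006, Ch. I, Thm. 2.8, Thm. 2.13 and Thm. 4.10]
[cite: SerreLocalFields1979, Ch. IV §4, Prop. 17] -/
theorem relIndex_level_eq_two_mul_rat_of_mem_frobeniusClassPrimes (inv : LocalInvariants ℚ 2)
    (hperf : inv.IsPerfect) (hvan : inv.SumLocalTermEqZero) (hcomp : inv.SelmerComplement)
    (hEP : ∀ v : HeightOneSpectrum (𝓞 ℚ), localEulerPoincareCharacteristic (v.adicCompletion ℚ))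
    (hreal : ∀ w : InfinitePlace ℚ, w.IsReal → Injective (inv (Sum.inl w)))
    {S : Set (HeightOneSpectrum (𝓞 ℚ))} {τ : absoluteGaloisGroup ℚ}
    (hτ : Nonempty (cokerSubOne (W.torsionGaloisModule ((2 : ℕ) : ℤ)) τ ≃+ ZMod 2))
    (T : Finset (HeightOneSpectrum (𝓞 ℚ)))
    (hT : ∀ q ∈ T, q ∈ frobeniusClassPrimes (W.torsionGaloisModule ((2 : ℕ) : ℤ)) S τ 2)
    {v₂ : HeightOneSpectrum (𝓞 ℚ)} (hv₂ : ((2 : ℕ) : 𝓞 ℚ) ∈ v₂.asIdeal) :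
    (SelmerStructure.selmerGroup (Function.update
          ((W.kummerSelmerStructure ((2 : ℕ) : ℤ)).transverseAt
            (cyclotomicTransverse (W.torsionGaloisModule ((2 : ℕ) : ℤ))) T) (Sum.inr v₂) ⊥ :
          SelmerStructure (W.torsionGaloisModule ((2 : ℕ) : ℤ)))).relIndex
        (SelmerStructure.selmerGroup (Function.update
          ((W.kummerSelmerStructure ((2 : ℕ) : ℤ)).transverseAt
            (cyclotomicTransverse (W.torsionGaloisModule ((2 : ℕ) : ℤ))) T) (Sum.inr v₂) ⊤ :
          SelmerStructure (W.torsionGaloisModule ((2 : ℕ) : ℤ)))) =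
      2 * Nat.card (nsmulAddMonoidHom 2 : (W.baseChange (v₂.adicCompletion ℚ)).toAffine.Point →+ _).ker := by
  haveI : Fact (Nat.Prime 2) := ⟨Nat.prime_two⟩
  have hτμ : τ ∈ rootsOfUnityFixer ℚ 2 := by
    rw [rootsOfUnityFixer_two_eq_top]
    exact Subgroup.mem_top τ
  rw [relIndex_transverseAt_update_bot_update_top_eq_of_mem_frobeniusClassPrimes W 2 inv hperf hvan hcomp hEP
      hreal hτ hτμ T hT (fun q _ => Literature.NumberTheory.Automorphic.Ash2003.residueCard_prime q)
      (fun q _ _ _ => GaloisImage.modPCyclotomicCharacter_surjOn_absInertia_rat_holds q) v₂,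
    GaloisImage.natCard_quot_adicCompletionIntegers_of_prime_mem 2 hv₂, mul_comm]

/-- **THE END STATEMENT — `a(T) − b(T) = 1 + e` at every Kolyvagin level, CONDITIONAL ON TWO NAMED FACTS
ONLY.**  For `E/ℚ`, `τ ∈ Γ_ℚ` with `E[2]/(τ − 1)E[2] ≃ ℤ/2`, any `S`, every finite
`T ⊆ frobeniusClassPrimes E[2] S τ 2` and the place `v₂ ∣ 2`:

  `[H¹_{𝓚(T)^{2}}(ℚ, E[2]) : H¹_{𝓚(T)_{2}}(ℚ, E[2])] = 2 · #E(ℚ_{v₂})[2]`,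

GIVEN the cited named facts `poitouTate_selmerStructure_duality_real ℚ` (Poitou–Tate duality for Selmer
structures with the real-place clause — Milne ADT I Ex. 1.6 (c), Thm. 4.10 (b); Howard Thm. 2.1.11;
filed by b2b-bsdres-lit GEN 53, p283639) and `localEulerPoincareCharacteristic (ℚ_v)` at every finite `v`
(Tate, Milne ADT I Thm. 2.8) — both HYPOTHESES here, not discharged.  The count being `inv`-free, no
family of local invariant maps appears in the statement.  ORDER v2.8 (ii-b) in the kernel modulo these
two facts; EVIDENCE-neutral; nothing booked; no mark / label / count moved; O1 OPEN.
[cite: MilneADT2006, Ch. I, Example 1.6 (c) (p. 19), Thm. 2.8, Thm. 2.13 and Thm. 4.10(b) (p. 57)]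
[cite: Howard2004HeegnerKolyvagin, Thm. 2.1.11 (arXiv:1202.6340 p. 6)]
[cite: MazurRubin2004, §3.5 and §4.3] [cite: MazurRubin2004Intro, Def. 4.2 and §5] -/
theorem relIndex_level_eq_two_mul_rat_of_facts (hPT : poitouTate_selmerStructure_duality_real ℚ)
    (hEP : ∀ v : HeightOneSpectrum (𝓞 ℚ), localEulerPoincareCharacteristic (v.adicCompletion ℚ))
    {S : Set (HeightOneSpectrum (𝓞 ℚ))} {τ : absoluteGaloisGroup ℚ}
    (hτ : Nonempty (cokerSubOne (W.torsionGaloisModule ((2 : ℕ) : ℤ)) τ ≃+ ZMod 2))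
    (T : Finset (HeightOneSpectrum (𝓞 ℚ)))
    (hT : ∀ q ∈ T, q ∈ frobeniusClassPrimes (W.torsionGaloisModule ((2 : ℕ) : ℤ)) S τ 2)
    {v₂ : HeightOneSpectrum (𝓞 ℚ)} (hv₂ : ((2 : ℕ) : 𝓞 ℚ) ∈ v₂.asIdeal) :
    (SelmerStructure.selmerGroup (Function.update
          ((W.kummerSelmerStructure ((2 : ℕ) : ℤ)).transverseAt
            (cyclotomicTransverse (W.torsionGaloisModule ((2 : ℕ) : ℤ))) T) (Sum.inr v₂) ⊥ :
          SelmerStructure (W.torsionGaloisModule ((2 : ℕ) : ℤ)))).relIndex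
        (SelmerStructure.selmerGroup (Function.update
          ((W.kummerSelmerStructure ((2 : ℕ) : ℤ)).transverseAt
            (cyclotomicTransverse (W.torsionGaloisModule ((2 : ℕ) : ℤ))) T) (Sum.inr v₂) ⊤ :
          SelmerStructure (W.torsionGaloisModule ((2 : ℕ) : ℤ)))) =
      2 * Nat.card (nsmulAddMonoidHom 2 : (W.baseChange (v₂.adicCompletion ℚ)).toAffine.Point →+ _).ker := by
  haveI : NeZero (2 : ℕ) := ⟨two_ne_zero⟩
  obtain ⟨inv, hperf, hvan, -, hcomp, hreal⟩ := hPT 2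
  exact relIndex_level_eq_two_mul_rat_of_mem_frobeniusClassPrimes W inv hperf hvan hcomp hEP hreal hτ T hT
    hv₂

/-- **Cardinality form of the END statement ("`#H¹_{𝓚(T)^{2}} = 2^{1+e} · #H¹_{𝓚(T)_{2}}`")**: under the
hypotheses of `relIndex_level_eq_two_mul_rat_of_facts`,
`#H¹_{𝓚(T)^{2}}(ℚ, E[2]) = 2 · #E(ℚ_{v₂})[2] · #H¹_{𝓚(T)_{2}}(ℚ, E[2])` — lens-2's `a(T) = b(T) + 1 + e` in
`𝔽₂`-dimensions once both groups are finite.  CONDITIONAL on the two named facts; nothing booked; O1 OPEN.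
[cite: MazurRubin2004Intro, Def. 4.2 and §5] [cite: MilneADT2006, Ch. I, Thm. 2.8 and Thm. 4.10(b)] -/
theorem natCard_selmerGroup_level_relaxed_eq_of_facts (hPT : poitouTate_selmerStructure_duality_real ℚ)
    (hEP : ∀ v : HeightOneSpectrum (𝓞 ℚ), localEulerPoincareCharacteristic (v.adicCompletion ℚ))
    {S : Set (HeightOneSpectrum (𝓞 ℚ))} {τ : absoluteGaloisGroup ℚ}
    (hτ : Nonempty (cokerSubOne (W.torsionGaloisModule ((2 : ℕ) : ℤ)) τ ≃+ ZMod 2))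
    (T : Finset (HeightOneSpectrum (𝓞 ℚ)))
    (hT : ∀ q ∈ T, q ∈ frobeniusClassPrimes (W.torsionGaloisModule ((2 : ℕ) : ℤ)) S τ 2)
    {v₂ : HeightOneSpectrum (𝓞 ℚ)} (hv₂ : ((2 : ℕ) : 𝓞 ℚ) ∈ v₂.asIdeal) :
    Nat.card (SelmerStructure.selmerGroup (Function.update
          ((W.kummerSelmerStructure ((2 : ℕ) : ℤ)).transverseAt
            (cyclotomicTransverse (W.torsionGaloisModule ((2 : ℕ) : ℤ))) T) (Sum.inr v₂) ⊤ :
          SelmerStructure (W.torsionGaloisModule ((2 : ℕ) : ℤ)))) =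
      2 * Nat.card (nsmulAddMonoidHom 2 : (W.baseChange (v₂.adicCompletion ℚ)).toAffine.Point →+ _).ker *
        Nat.card (SelmerStructure.selmerGroup (Function.update
          ((W.kummerSelmerStructure ((2 : ℕ) : ℤ)).transverseAt
            (cyclotomicTransverse (W.torsionGaloisModule ((2 : ℕ) : ℤ))) T) (Sum.inr v₂) ⊥ :
          SelmerStructure (W.torsionGaloisModule ((2 : ℕ) : ℤ)))) := by
  rw [natCard_selmerGroup_update_top_eq, relIndex_level_eq_two_mul_rat_of_facts W hPT hEP hτ T hT hv₂]

end RatTwo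

end Summit.BirchSwinnertonDyer.Rank1Residual.X5.TransverseCount

end
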